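import Summits.ABC.IUTFork.Conditional.AbcOfSGenuineKChosenDepth
import Summits.ABC.IUTFork.Conditional.HexDepthArithmetic
import Summits.ABC.IUTFork.Cor312GenuineKDeepDatumLam
import HarnessLib

/-!
# Branch C «HEX-KERNEL», FAMILY FORM: at EVERY genuine Θ-volume datum over EVERY deep `λ_k` (`k ≥ k*`) and EVERY prime
# `l ∈ [11, 60k]`, the top-label packet over `7` is DEEP — so the (xi-f) licence / the hull-level S_H clause of the line of
# record fail AT ALL THESE DATA (not only at one witness)

PROOF-ONLY file (D-0012; 0 definitions, 0 `Prop` facts) of the abc-iut cell (Cor. 3.12 sub-crew seat abc-iut-c312-7, gen 4; sequel of this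
seat's bricks p441123 / p442895 / p443067 and of the assembly of record `Conditional.not_hSH_v6K` (abc-iut-C-cert-1, p443604), which exhibits
ONE deep admissible datum). TAKES NO SIDE on [IUTchIII] Cor. 3.12 (S. Mochizuki, *Inter-universal Teichmüller theory III*, RIMS manuscript,
Cor. 3.12 p. 173–174, Step (xi-f) p. 184) or on any author.

WHAT IS ADDED (composition BY NAME; no new engine): the depth witness is UNIFORM over a cofinal family —
* §1 `GenuineK.exists_deep_place_lamSeven_all` — ∃ `k*`, ∀ `k ≥ k*`, ∀ prime `l` with `11 ≤ l ≤ 60k`, ∀ `T : Cor22.ThetaVolumeDatumAt (ratPoint λ_k) l`: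
  at the TOP label `i = (l−1)/2 − 1` there is a fibre point `x₀ | 7` with abc-iut-w5-d107's explicit depth inequality
  `7^{((i+2)(d+a+b)+1)}·‖t_q(x₀)‖^{(i+1)²−1} < 1` for the CHOSEN realising q-idele — this seat's `GenuineK.exists_place_lamSeven`
  (`‖t_q(x₀)‖ = 7^{−k/l}`, `d+a+b ≤ 2 + log_7(46080·l(l−1)²(l+1))`, TAME route: no degree bound of `T.K`) fed into abc-iut-C-cert-1's
  arithmetic core `Hex.core_ineq` (p442144) at `N := 46080·l(l−1)²(l+1) ≤ 92160·l⁴`, `τ := 7^{−k/l}`;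
* CONSEQUENCE (one `obtain` on §1, per datum, for EVERY choice of the context binders): the (xi-f) LICENCE FAILS at abc-iut-c312-7's
  `Real.settingPrVolSharp (pilotDataOfK T.D T.K) …` with the chosen realising ideles (abc-iut-w5-d107
  `Thm311.Real.not_licence_settingPrVolSharp_of_realises_explicit`, p437756), and the per-datum instance of the `hSH` binder of `abc_of_SH_v6K`
  fails (abc-iut-C-cert-1 `GenuineK.not_pilotKummerCompatHull_chosen_of_explicit_depth`, p438886) — at ALL these data. The apex `not_hSH_v6K`
  is abc-iut-C-cert-1's p443604 (degree route, ONE witness); §1 is its tame-route, ALL-DATA strengthening (no degree bound of `T.K` used).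

HONEST SCOPE: SHARP reading; the per-label licence is a STRONGER-THAN-PRINT sufficient form of (xi-f) (ADJUDICATION-SPEC (G1′)); failure at the
deep top-label packet says NOTHING about the printed GLOBAL inequality `−|log(q)| ≤ −|log(Θ)|` (compensation across packets), the number-level
`Cor22.Cor312AtDatum`, or the downstream certificate `abc_of_cor312Statement_genuineM`; no side taken on any author; typed ≠ proved;
refuted-as-typed ≠ refuted-in-print. [cite: Mochizuki2012, IUTchIII Cor. 3.12 Step (xi-f) p. 184; IUTchI Ex. 3.2 (iv) p. 71; IUTchIV Prop. 1.2 p. 10, Thm. 1.10 Steps (ii)–(iii) p. 24–26, Cor. 2.2 (ii) proof p. 45–46]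
[cite: ScholzeStix2018, §2.2 pp. 9–10] [cite: DupuyHilado2025, §3.4, §4.10] [claim: Mochizuki2012, status: disputed] for every IUT quotation.
-/

noncomputable section

open Set Function NumberField IsDedekindDomain

namespace Summit.ABC.IUTFork.Conditional

open Thm311 Thm311.Real Cor312 Cor312Vol Cor312Prov Literature.IUT.LogThetaLattice Literature.IUT.LogVolume
  Literature.IUT.HodgeTheaters Literature.NumberTheory.DiophantineGeometry.GenEll Summit.ABC.ABC.Theorems

/-! ## §1. Every datum over every deep `λ_k` carries a deep top-label packet over `7` -/

/-- **Uniform depth.** There is `k*` such that for all `k ≥ k*`, all primes `l` with `11 ≤ l ≤ 60k` and EVERY genuine Θ-volume datum `T` at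
`(ratPoint λ_k, l)`, the top label `i = (l−1)/2 − 1` and some fibre point `x₀ | 7` satisfy the explicit depth inequality
`7^{((i+2)(d+a+b)+1)}·‖t_q(x₀)‖^{(i+1)²−1} < 1` at the chosen realising q-idele (`GenuineK.exists_place_lamSeven` + `Hex.core_ineq`; tame
route, `N := 46080·l(l−1)²(l+1)`). [cite: Mochizuki2012, IUTchIV Prop. 1.2 p. 10, Cor. 2.2 (ii) proof (P5) p. 46] [claim: Mochizuki2012, status: disputed] -/
theorem GenuineK.exists_deep_place_lamSeven_all :
    ∃ kstar : ℕ, 1 ≤ kstar ∧ ∀ (k l : ℕ), kstar ≤ k → l.Prime → 11 ≤ l → (l : ℝ) ≤ 60 * k →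
      ∀ (T : Cor22.ThetaVolumeDatumAt (ratPoint ((2 : ℚ)⁻¹ + 2 / 7 ^ k)) l),
      letI := T.instFieldF; letI := T.instNumberFieldF; letI := T.instAlgebraF; letI := T.instFieldK
      letI := T.instNumberFieldK; letI := T.instAlgebraK; letI := T.instFieldFbar; letI := T.instAlgebraFbar
      letI := T.instAlgebraKFbar; letI := T.instIsElliptic
      haveI : Fact (Nat.Prime 7) := ⟨by norm_num⟩
      ∃ (i : Fin (thetaIndex (pilotDataOfK T.D T.K)).lstar) (x₀ : (thetaIndex (pilotDataOfK T.D T.K)).Fibre (.inr ⟨7, by norm_num⟩)),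
        (i : ℕ) = (l - 1) / 2 - 1 ∧
        placeOf (pilotDataOfK T.D T.K) 7 x₀ ∈ (pilotDataOfK T.D T.K).S ∧
        (7 : ℝ) ^ ((((i : ℕ) : ℝ) + 2) * (differentOrd 7 (kOf (pilotDataOfK T.D T.K) 7 x₀)
            + logRadiusA 7 (absRamificationIdx 7 (kOf (pilotDataOfK T.D T.K) 7 x₀))
            + logRadiusB 7 (absRamificationIdx 7 (kOf (pilotDataOfK T.D T.K) 7 x₀))) + 1) *
          ‖(exists_realising_qIdeles_pilotDataOfK T.D).choose ⟨7, by norm_num⟩ x₀‖ ^ (((i : ℕ) + 1) ^ 2 - 1) < 1 := by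
  classical
  obtain ⟨k₁, hk₁⟩ := Hex.core_ineq
  refine ⟨max k₁ 1, le_max_right _ _, fun k l hk hl h11 hl60 T => ?_⟩
  have hk1 : 1 ≤ k := le_trans (le_max_right _ _) hk
  letI := T.instFieldF; letI := T.instNumberFieldF; letI := T.instAlgebraF; letI := T.instFieldK
  letI := T.instNumberFieldK; letI := T.instAlgebraK; letI := T.instFieldFbar; letI := T.instAlgebraFbar
  letI := T.instAlgebraKFbar; letI := T.instIsElliptic
  haveI : Fact (Nat.Prime 7) := ⟨by norm_num⟩
  obtain ⟨x₀, hS, -, -, hB, hnorm⟩ := GenuineK.exists_place_lamSeven hk1 hl h11 T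
  -- the top label
  have hlstar : (thetaIndex (pilotDataOfK T.D T.K)).lstar = (l - 1) / 2 := rfl
  have hil : (l - 1) / 2 - 1 < (thetaIndex (pilotDataOfK T.D T.K)).lstar := by rw [hlstar]; omega
  refine ⟨⟨(l - 1) / 2 - 1, hil⟩, x₀, rfl, hS, ?_⟩
  -- the constants
  set N : ℕ := 46080 * (l * (l - 1) ^ 2 * (l + 1)) with hNdef
  have hN1 : 1 ≤ N := by
    have h2 : 1 ≤ l * (l - 1) ^ 2 := Nat.one_le_iff_ne_zero.mpr (Nat.mul_ne_zero (by omega) (pow_ne_zero _ (by omega)))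
    have : 1 ≤ l * (l - 1) ^ 2 * (l + 1) := Nat.one_le_iff_ne_zero.mpr (Nat.mul_ne_zero (by omega) (by omega))
    omega
  have hN : N ≤ 184320 * l ^ 4 := by
    have h1 : (l - 1) ^ 2 ≤ l ^ 2 := Nat.pow_le_pow_left (by omega) 2
    have h2 : l + 1 ≤ 2 * l := by omega
    calc N = 46080 * (l * (l - 1) ^ 2 * (l + 1)) := rfl
      _ ≤ 46080 * (l * l ^ 2 * (2 * l)) := by gcongr
      _ = 92160 * l ^ 4 := by ring
      _ ≤ 184320 * l ^ 4 := by omega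
  have hodd : l % 2 = 1 := by
    rcases hl.eq_two_or_odd with h | h
    · omega
    · exact h
  have h7 : (1 : ℝ) < 7 := by norm_num
  have hτ0 : (0 : ℝ) ≤ (7 : ℝ) ^ (-((k : ℝ) / l)) := by positivity
  have hcore := hk₁ k l N ((7 : ℝ) ^ (-((k : ℝ) / l))) (le_trans (le_max_left _ _) hk) h11 hodd hl60 hN1 hN hτ0 le_rfl
  -- monotonicity `d + a + b ≤ 2 + log_7 N ≤ 4 + 2·logb 7 N`
  have hlogbN : 0 ≤ Real.logb 7 N := Real.logb_nonneg h7 (by exact_mod_cast hN1)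
  have hB' : differentOrd 7 (kOf (pilotDataOfK T.D T.K) 7 x₀)
        + logRadiusA 7 (absRamificationIdx 7 (kOf (pilotDataOfK T.D T.K) 7 x₀))
        + logRadiusB 7 (absRamificationIdx 7 (kOf (pilotDataOfK T.D T.K) 7 x₀)) ≤ 4 + 2 * Real.logb 7 N := by
    have : Real.log ((N : ℕ) : ℝ) / Real.log 7 = Real.logb 7 N := rfl
    rw [hNdef] at this hlogbN
    rw [hNdef]
    linarith [hB]
  have hexp : ((((((l - 1) / 2 - 1 : ℕ)) : ℝ) + 2) * (differentOrd 7 (kOf (pilotDataOfK T.D T.K) 7 x₀)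
        + logRadiusA 7 (absRamificationIdx 7 (kOf (pilotDataOfK T.D T.K) 7 x₀))
        + logRadiusB 7 (absRamificationIdx 7 (kOf (pilotDataOfK T.D T.K) 7 x₀))) + 1) ≤
      (((((l - 1) / 2 - 1 : ℕ)) : ℝ) + 2) * (4 + 2 * Real.logb 7 N) + 1 := by
    have hi : (0 : ℝ) ≤ ((((l - 1) / 2 - 1 : ℕ)) : ℝ) + 2 := by positivity
    nlinarith [mul_le_mul_of_nonneg_left hB' hi]
  have hpow : (7 : ℝ) ^ ((((((l - 1) / 2 - 1 : ℕ)) : ℝ) + 2) * (differentOrd 7 (kOf (pilotDataOfK T.D T.K) 7 x₀)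
        + logRadiusA 7 (absRamificationIdx 7 (kOf (pilotDataOfK T.D T.K) 7 x₀))
        + logRadiusB 7 (absRamificationIdx 7 (kOf (pilotDataOfK T.D T.K) 7 x₀))) + 1) ≤
      (7 : ℝ) ^ ((((((l - 1) / 2 - 1 : ℕ)) : ℝ) + 2) * (4 + 2 * Real.logb 7 N) + 1) :=
    Real.rpow_le_rpow_of_exponent_le h7.le hexp
  have hτn : (0 : ℝ) ≤ ((7 : ℝ) ^ (-((k : ℝ) / l))) ^ (((l - 1) / 2) ^ 2 - 1) := pow_nonneg hτ0 _
  have hidx : ((l - 1) / 2 - 1) + 1 = (l - 1) / 2 := by omega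
  show (7 : ℝ) ^ _ * ‖(exists_realising_qIdeles_pilotDataOfK T.D).choose ⟨7, by norm_num⟩ x₀‖ ^ ((((l - 1) / 2 - 1) + 1) ^ 2 - 1) < 1
  rw [hnorm, hidx]
  calc (7 : ℝ) ^ _ * ((7 : ℝ) ^ (-((k : ℝ) / l))) ^ (((l - 1) / 2) ^ 2 - 1)
      ≤ (7 : ℝ) ^ ((((((l - 1) / 2 - 1 : ℕ)) : ℝ) + 2) * (4 + 2 * Real.logb 7 N) + 1) *
          ((7 : ℝ) ^ (-((k : ℝ) / l))) ^ (((l - 1) / 2) ^ 2 - 1) := mul_le_mul_of_nonneg_right hpow hτn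
    _ < 1 := hcore

end Summit.ABC.IUTFork.Conditional

end
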